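import Summits.ResolutionOfSingularities.ResolutionOfSingularities.Theorems.WildQuotientsSummitReductionStubPairOrbitNormalFormBlowupChartsOverCentreFamilies
import Summits.ResolutionOfSingularities.ResolutionOfSingularities.Theorems.WildQuotientsSummitReductionStubPairOrbitNormalFormBlowupChartsOverCentreNodeCase
import Summits.ResolutionOfSingularities.ResolutionOfSingularities.Theorems.WildQuotientsSummitReductionStubPairOrbitNormalFormBlowupChartsOverCentreSection
import Summits.ResolutionOfSingularities.ResolutionOfSingularities.Theorems.WildQuotientsSummitReductionStubPairOrbitNormalFormBlowupModelCharts7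
import HarnessLib

/-!
# `WildQuotients.SummitReduction` (stmt-ResolutionOfSingularities-16324), line `FramePerfect`, stub NB2
# (`stub_pair_orbitNormalFormBlowup_modelChartsOverCentre`): the chart packages of the blown-up model,
# charts "`u ≠ 0`" and "`v ≠ 0`"

Route `ResolutionOfSingularities/WildQuotients`, crux `SummitReduction`; helper file of stub NB2
(de Jong 1996, 4.27 [C2] on the coefficient-free model). For the model `P = A⟦u, v⟧` over a regular
local ring `A` with regular system of parameters `(x, y, w)`, the relation `uv - h`,
`h = x y ∏_{k ∈ S} w_k`, the centre `𝔓 = (u, v, x, y)` and a maximal ideal `𝔔` of a chart `P[𝔓/g]`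
over `𝔪_P` with local ring `L`, the CHART PACKAGE at `𝔔` is: a strict transform `f` (`uv - h = g² f`)
with `O = L/(f)` local, the exceptional generator `ḡ` a non-zero-divisor of `O`, the boundary
`x y ∏_{k ∈ T} w_k = g² w'` with `√((g² w') Ô) = (g w') Ô`, local strict normal crossings data for
`(g w')` if `O` is regular, and `Ô ≅ A'⟦U, V⟧/(UV - ∏_{i<s'} t'ᵢ)` carrying `(g w') Ô` to
`(∏_{i<r'} t'ᵢ)` if not (the shape of the conclusion of NB2, to be transported to `𝒪_{B,y} ≅ O`).
PROVED here for the charts `g = u` and `g = v` (de Jong 1996, p. 76: "Chart "`u ≠ 0`" … Clearly,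
this is smooth and `Z` is given by `ut₁'t₂'t₃ ⋯ t_r = 0`, a normal crossings divisor"), from the
generic regular package `modelChartsOverCentre_chartX_package`:

* `modelChartsOverCentre_relation_eq`, `…_relation_eq_of`, `…_C_boundary(_of)`, `…_mem_centre`,
  `…_boundary_factor`, `…_span_swap`, `…_range_append_swap` — bookkeeping on the model;
* `modelChartsOverCentre_package_X0`, `modelChartsOverCentre_package_X1` — the packages.

## Sources

* A. J. de Jong, *Smoothness, semi-stability and alterations*, Publ. Math. IHÉS 83 (1996), 4.27,
  p. 76. [DeJong1996]
* A. J. de Jong, *Families of curves and alterations*, Ann. Inst. Fourier 47 (1997), proof of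
  Prop. 5.11, p. 619 (the same charts over an arbitrary regular local base). [DeJong1997]
-/

set_option linter.dupNamespace false -- the tree's summit namespace repeats `ResolutionOfSingularities`

noncomputable section

open IsLocalRing
open Literature.AlgebraicGeometry.Resolution

namespace Summit.ResolutionOfSingularities.ResolutionOfSingularities.Theorems

/-- The model relation in terms of the four generators of the centre:
`uv - h = X₀X₁ - (C x)(C y) C(∏_{k ∈ S} w_k)` for `h = x y ∏_{k ∈ S} w_k`. [cite: DeJong1996, 4.27, p. 76] -/
theorem modelChartsOverCentre_relation_eq {A : Type} [CommRing A] {l : ℕ} (x y : A) (w : Fin l → A)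
    (S : Finset (Fin l)) (h : A) (hh : h = x * y * ∏ k ∈ S, w k) :
    DeJong1996.nodeDeformationRelation A h = (![MvPowerSeries.X 0, MvPowerSeries.X 1, MvPowerSeries.C x, MvPowerSeries.C y] : Fin 4 → MvPowerSeries
          (Fin 2) A) 0 * (![MvPowerSeries.X 0, MvPowerSeries.X 1, MvPowerSeries.C x, MvPowerSeries.C y] : Fin 4 → MvPowerSeries (Fin 2) A) 1 -
          (![MvPowerSeries.X 0, MvPowerSeries.X 1, MvPowerSeries.C x, MvPowerSeries.C y] : Fin 4 → MvPowerSeries (Fin 2) A) 2 * (![MvPowerSeries.X 0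
          , MvPowerSeries.X 1, MvPowerSeries.C x, MvPowerSeries.C y] : Fin 4 → MvPowerSeries (Fin 2) A) 3 * MvPowerSeries.C (∏ k ∈ S, w k) := by
  rw [DeJong1996.nodeDeformationRelation, hh, map_mul, map_mul]
  rfl

/-- The model relation for a reordering `c` of the four generators, the further branches as a
product of constants. [cite: DeJong1996, 4.27, p. 76] -/
theorem modelChartsOverCentre_relation_eq_of {A : Type} [CommRing A] {l : ℕ} (x y : A) (w : Fin l → A)
    (S : Finset (Fin l)) (h : A) (hh : h = x * y * ∏ k ∈ S, w k) (c : Fin 4 → MvPowerSeries (Fin 2) A)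
    (h01 : c 0 * c 1 = MvPowerSeries.X 0 * MvPowerSeries.X 1)
    (h23 : c 2 * c 3 = MvPowerSeries.C x * MvPowerSeries.C y) :
    DeJong1996.nodeDeformationRelation A h = c 0 * c 1 - c 2 * c 3 * ∏ k ∈ S, MvPowerSeries.C (w k) := by
  rw [DeJong1996.nodeDeformationRelation, hh, map_mul, map_mul, map_prod, h01, h23]

/-- The constant `C(x y ∏_{k ∈ T} w_k)` in terms of a reordering `c` of the generators. [folklore] -/
theorem modelChartsOverCentre_C_boundary_of {A : Type} [CommRing A] {l : ℕ} (x y : A) (w : Fin l → A)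
    (T : Finset (Fin l)) (b : A) (hb : b = x * y * ∏ k ∈ T, w k) (c : Fin 4 → MvPowerSeries (Fin 2) A)
    (h23 : c 2 * c 3 = MvPowerSeries.C x * MvPowerSeries.C y) :
    (MvPowerSeries.C b : MvPowerSeries (Fin 2) A) = c 2 * c 3 * ∏ k ∈ T, MvPowerSeries.C (w k) := by
  rw [hb, map_mul, map_mul, map_prod, h23]

/-- The constant `C(x y ∏_{k ∈ T} w_k)` as a product of constants. [folklore] -/
theorem modelChartsOverCentre_C_boundary {A : Type} [CommRing A] {l : ℕ} (x y : A) (w : Fin l → A)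
    (T : Finset (Fin l)) (b : A) (hb : b = x * y * ∏ k ∈ T, w k) :
    (MvPowerSeries.C b : MvPowerSeries (Fin 2) A) = MvPowerSeries.C x * MvPowerSeries.C y * ∏ k ∈ T, MvPowerSeries.C (w k) := by
  rw [hb, map_mul, map_mul, map_prod]

/-- The four generators lie in the centre. [folklore] -/
theorem modelChartsOverCentre_mem_centre {A : Type} [CommRing A] (x y : A)
    (𝔓 : Ideal (MvPowerSeries (Fin 2) A)) (h𝔓 : 𝔓 = Ideal.span (Set.range (![MvPowerSeries.X 0, MvPowerSeries.X 1, MvPowerSeries.C x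
          , MvPowerSeries.C y] : Fin 4 → MvPowerSeries (Fin 2) A))) (k : Fin 4) :
    (![MvPowerSeries.X 0, MvPowerSeries.X 1, MvPowerSeries.C x, MvPowerSeries.C y] : Fin 4 → MvPowerSeries (Fin 2) A) k ∈ 𝔓 := by
  rw [h𝔓]
  exact Ideal.subset_span ⟨k, rfl⟩

/-- In the quotient of the chart: `x · y · Π = x² · ((y/x) · Π)` once `y = (y/x) · x`. [folklore] -/
theorem modelChartsOverCentre_boundary_factor {R : Type} [CommRing R] {ax ay e3 pr : R} (h : ay = e3 * ax) :
    ax * ay * pr = ax ^ 2 * (e3 * pr) := by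
  rw [h]; ring

set_option maxHeartbeats 4000000 in
/-- **The chart package on the chart "`u ≠ 0`"** of the blown-up model at a closed point over the
closed point: with `f` the strict transform of `uv - h` (`uv - h = u² f` on the chart), `O = L/(f)` is
regular, the exceptional generator `u` is a non-zero-divisor of `O`, the boundary `x y ∏_{k ∈ T} w_k`
is `u² w'` with `√((u² w') Ô) = (u w') Ô` and `(u w')` an ideal with local strict normal crossings
data (de Jong 1996, 4.27: "Chart "`u ≠ 0`" … Clearly, this is smooth and `Z` is given by
`ut₁'t₂'t₃ ⋯ t_r = 0`, a normal crossings divisor"; the chart "`v ≠ 0`" is symmetric).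
[cite: DeJong1996, 4.27, p. 76] -/
theorem modelChartsOverCentre_package_X0 {A : Type} [CommRing A] [IsRegularLocalRing A] {l : ℕ}
    (x y : A) (w : Fin l → A) (S T : Finset (Fin l)) (_hST : S ⊆ T)
    (hzA : Ideal.span (Set.range (Fin.append ![x, y] w)) = maximalIdeal A)
    (hdA : (maximalIdeal A).spanFinrank = 2 + l)
    (h b : A) (hh : h = x * y * ∏ k ∈ S, w k) (hb : b = x * y * ∏ k ∈ T, w k)
    (𝔓 : Ideal (MvPowerSeries (Fin 2) A)) (h𝔓 : 𝔓 = Ideal.span (Set.range (![MvPowerSeries.X 0, MvPowerSeries.X 1, MvPowerSeries.C x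
          , MvPowerSeries.C y] : Fin 4 → MvPowerSeries (Fin 2) A)))
    (𝔔 : Ideal (blowupAlgebra 𝔓 (MvPowerSeries.X 0))) [𝔔.IsMaximal]
    (h𝔔 : 𝔔.comap (algebraMap (MvPowerSeries (Fin 2) A) (blowupAlgebra 𝔓 (MvPowerSeries.X 0))) = maximalIdeal (MvPowerSeries (Fin 2) A))
    (hfmem : ∀ f : blowupAlgebra 𝔓 (MvPowerSeries.X 0), algebraMap (MvPowerSeries (Fin 2) A) (blowupAlgebra 𝔓 (MvPowerSeries.X 0))
          (DeJong1996.nodeDeformationRelation A h) = algebraMap (MvPowerSeries (Fin 2) A) (blowupAlgebra 𝔓 (MvPowerSeries.X 0))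
          (MvPowerSeries.X 0) ^ 2 * f → f ∈ 𝔔)
    (L : Type) [CommRing L] [IsLocalRing L] [Algebra (blowupAlgebra 𝔓 (MvPowerSeries.X 0)) L] [IsLocalization.AtPrime L 𝔔] :
    ∃ (f : blowupAlgebra 𝔓 (MvPowerSeries.X 0)) (_ : IsLocalRing (L ⧸ Ideal.span {algebraMap (blowupAlgebra 𝔓 (MvPowerSeries.X 0)) L (f)})),
      algebraMap (MvPowerSeries (Fin 2) A) (blowupAlgebra 𝔓 (MvPowerSeries.X 0)) (DeJong1996.nodeDeformationRelation A h) = algebraMap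
            (MvPowerSeries (Fin 2) A) (blowupAlgebra 𝔓 (MvPowerSeries.X 0)) (MvPowerSeries.X 0) ^ 2 * f ∧
      Ideal.Quotient.mk (Ideal.span {algebraMap (blowupAlgebra 𝔓 (MvPowerSeries.X 0)) L (f)}) (algebraMap (blowupAlgebra 𝔓 (MvPowerSeries.X 0)) L
            (algebraMap (MvPowerSeries (Fin 2) A) (blowupAlgebra 𝔓 (MvPowerSeries.X 0)) (MvPowerSeries.X 0))) ∈ nonZeroDivisors
            (L ⧸ Ideal.span {algebraMap (blowupAlgebra 𝔓 (MvPowerSeries.X 0)) L (f)}) ∧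
      ∃ w' : (L ⧸ Ideal.span {algebraMap (blowupAlgebra 𝔓 (MvPowerSeries.X 0)) L (f)}),
        Ideal.span {Ideal.Quotient.mk (Ideal.span {algebraMap (blowupAlgebra 𝔓 (MvPowerSeries.X 0)) L (f)}) (algebraMap (blowupAlgebra 𝔓
              (MvPowerSeries.X 0)) L (algebraMap (MvPowerSeries (Fin 2) A) (blowupAlgebra 𝔓 (MvPowerSeries.X 0)) (MvPowerSeries.C b)))}
              = Ideal.span {Ideal.Quotient.mk (Ideal.span {algebraMap (blowupAlgebra 𝔓 (MvPowerSeries.X 0)) L (f)}) (algebraMap (blowupAlgebra 𝔓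
              (MvPowerSeries.X 0)) L (algebraMap (MvPowerSeries (Fin 2) A) (blowupAlgebra 𝔓 (MvPowerSeries.X 0)) (MvPowerSeries.X 0))) ^ 2 * w'} ∧
        ((Ideal.span {Ideal.Quotient.mk (Ideal.span {algebraMap (blowupAlgebra 𝔓 (MvPowerSeries.X 0)) L (f)}) (algebraMap (blowupAlgebra 𝔓
              (MvPowerSeries.X 0)) L (algebraMap (MvPowerSeries (Fin 2) A) (blowupAlgebra 𝔓 (MvPowerSeries.X 0)) (MvPowerSeries.C b)))}).map
              (algebraMap (L ⧸ Ideal.span {algebraMap (blowupAlgebra 𝔓 (MvPowerSeries.X 0)) L (f)}) (AdicCompletion (maximalIdeal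
              (L ⧸ Ideal.span {algebraMap (blowupAlgebra 𝔓 (MvPowerSeries.X 0)) L (f)})) (L ⧸ Ideal.span {algebraMap (blowupAlgebra 𝔓
              (MvPowerSeries.X 0)) L (f)})))).radical =
          (Ideal.span {Ideal.Quotient.mk (Ideal.span {algebraMap (blowupAlgebra 𝔓 (MvPowerSeries.X 0)) L (f)}) (algebraMap (blowupAlgebra 𝔓
                (MvPowerSeries.X 0)) L (algebraMap (MvPowerSeries (Fin 2) A) (blowupAlgebra 𝔓 (MvPowerSeries.X 0)) (MvPowerSeries.X 0))) * w'}).map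
                (algebraMap (L ⧸ Ideal.span {algebraMap (blowupAlgebra 𝔓 (MvPowerSeries.X 0)) L (f)}) (AdicCompletion (maximalIdeal
                (L ⧸ Ideal.span {algebraMap (blowupAlgebra 𝔓 (MvPowerSeries.X 0)) L (f)})) (L ⧸ Ideal.span {algebraMap (blowupAlgebra 𝔓
                (MvPowerSeries.X 0)) L (f)}))) ∧
        (IsRegularLocalRing (L ⧸ Ideal.span {algebraMap (blowupAlgebra 𝔓 (MvPowerSeries.X 0)) L (f)}) → IsSNCIdeal (Ideal.span {Ideal.Quotient.mk
              (Ideal.span {algebraMap (blowupAlgebra 𝔓 (MvPowerSeries.X 0)) L (f)}) (algebraMap (blowupAlgebra 𝔓 (MvPowerSeries.X 0)) L (algebraMap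
              (MvPowerSeries (Fin 2) A) (blowupAlgebra 𝔓 (MvPowerSeries.X 0)) (MvPowerSeries.X 0))) * w'})) ∧
        (¬ IsRegularLocalRing (L ⧸ Ideal.span {algebraMap (blowupAlgebra 𝔓 (MvPowerSeries.X 0)) L (f)}) →
          ∃ (A' : Type) (_ : CommRing A') (_ : IsRegularLocalRing A') (t' : Fin (l + 2) → A') (s' r' : ℕ),
            Ideal.span (Set.range t') = maximalIdeal A' ∧ ringKrullDim A' = (l + 2 : ℕ) ∧
            2 ≤ s' ∧ s' ≤ r' ∧ r' ≤ l + 2 ∧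
            ∃ e : AdicCompletion (maximalIdeal (L ⧸ Ideal.span {algebraMap (blowupAlgebra 𝔓 (MvPowerSeries.X 0)) L (f)}))
                  (L ⧸ Ideal.span {algebraMap (blowupAlgebra 𝔓 (MvPowerSeries.X 0)) L (f)}) ≃+*
                DeJong1996.NodeDeformationRing A'
                  (∏ i ∈ Finset.univ.filter (fun i : Fin (l + 2) => i.val < s'), t' i),
              ((Ideal.span {Ideal.Quotient.mk (Ideal.span {algebraMap (blowupAlgebra 𝔓 (MvPowerSeries.X 0)) L (f)}) (algebraMap (blowupAlgebra 𝔓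
                    (MvPowerSeries.X 0)) L (algebraMap (MvPowerSeries (Fin 2) A) (blowupAlgebra 𝔓 (MvPowerSeries.X 0)) (MvPowerSeries.X 0)))
                    * w'}).map (algebraMap (L ⧸ Ideal.span {algebraMap (blowupAlgebra 𝔓 (MvPowerSeries.X 0)) L (f)}) _)).map e.toRingHom =
                Ideal.span {DeJong1996.NodeDeformationRing.ofBase A' _
                  (∏ i ∈ Finset.univ.filter (fun i : Fin (l + 2) => i.val < r'), t' i)}) := by
  classical
  haveI := isRegularLocalRing_mvPowerSeries_of_isRegularLocalRing A 2
  have hc : ∀ k, (![MvPowerSeries.X 0, MvPowerSeries.X 1, MvPowerSeries.C x, MvPowerSeries.C y] : Fin 4 → MvPowerSeries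
        (Fin 2) A) k ∈ 𝔓 := modelChartsOverCentre_mem_centre x y 𝔓 h𝔓
  obtain ⟨hzP, hdP⟩ := chartsOverCentre_model_rsop x y w hzA hdA
  have hF := modelChartsOverCentre_relation_eq_of x y w S h hh (![MvPowerSeries.X 0, MvPowerSeries.X 1, MvPowerSeries.C x
        , MvPowerSeries.C y] : Fin 4 → MvPowerSeries (Fin 2) A) rfl rfl
  have hfF : algebraMap (MvPowerSeries (Fin 2) A) (blowupAlgebra 𝔓 (MvPowerSeries.X 0)) (DeJong1996.nodeDeformationRelation A h) = algebraMap
        (MvPowerSeries (Fin 2) A) (blowupAlgebra 𝔓 (MvPowerSeries.X 0)) (MvPowerSeries.X 0) ^ 2 * (blowupAlgebra.gen 𝔓 (MvPowerSeries.X 0)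
        ((![MvPowerSeries.X 0, MvPowerSeries.X 1, MvPowerSeries.C x, MvPowerSeries.C y] : Fin 4 → MvPowerSeries (Fin 2) A) 0) (hc 0)
        * blowupAlgebra.gen 𝔓 (MvPowerSeries.X 0) ((![MvPowerSeries.X 0, MvPowerSeries.X 1, MvPowerSeries.C x, MvPowerSeries.C y] : Fin 4
        → MvPowerSeries (Fin 2) A) 1) (hc 1) - blowupAlgebra.gen 𝔓 (MvPowerSeries.X 0) ((![MvPowerSeries.X 0, MvPowerSeries.X 1, MvPowerSeries.C x
        , MvPowerSeries.C y] : Fin 4 → MvPowerSeries (Fin 2) A) 2) (hc 2) * blowupAlgebra.gen 𝔓 (MvPowerSeries.X 0) ((![MvPowerSeries.X 0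
        , MvPowerSeries.X 1, MvPowerSeries.C x, MvPowerSeries.C y] : Fin 4 → MvPowerSeries (Fin 2) A) 3) (hc 3) * algebraMap (MvPowerSeries
        (Fin 2) A) (blowupAlgebra 𝔓 (MvPowerSeries.X 0)) (∏ k ∈ S, MvPowerSeries.C (w k))) := by
    rw [hF]
    exact modelChartsOverCentre_algebraMap_relation_of_eq (![MvPowerSeries.X 0, MvPowerSeries.X 1, MvPowerSeries.C x, MvPowerSeries.C y] : Fin 4
          → MvPowerSeries (Fin 2) A) 𝔓 hc 0 (MvPowerSeries.X 0) rfl _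
  have hf𝔔 := hfmem _ hfF
  haveI hO : IsLocalRing (L ⧸ Ideal.span {algebraMap (blowupAlgebra 𝔓 (MvPowerSeries.X 0)) L (blowupAlgebra.gen 𝔓 (MvPowerSeries.X 0)
        ((![MvPowerSeries.X 0, MvPowerSeries.X 1, MvPowerSeries.C x, MvPowerSeries.C y] : Fin 4 → MvPowerSeries (Fin 2) A) 0) (hc 0)
        * blowupAlgebra.gen 𝔓 (MvPowerSeries.X 0) ((![MvPowerSeries.X 0, MvPowerSeries.X 1, MvPowerSeries.C x, MvPowerSeries.C y] : Fin 4
        → MvPowerSeries (Fin 2) A) 1) (hc 1) - blowupAlgebra.gen 𝔓 (MvPowerSeries.X 0) ((![MvPowerSeries.X 0, MvPowerSeries.X 1, MvPowerSeries.C x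
        , MvPowerSeries.C y] : Fin 4 → MvPowerSeries (Fin 2) A) 2) (hc 2) * blowupAlgebra.gen 𝔓 (MvPowerSeries.X 0) ((![MvPowerSeries.X 0
        , MvPowerSeries.X 1, MvPowerSeries.C x, MvPowerSeries.C y] : Fin 4 → MvPowerSeries (Fin 2) A) 3) (hc 3) * algebraMap (MvPowerSeries
        (Fin 2) A) (blowupAlgebra 𝔓 (MvPowerSeries.X 0)) (∏ k ∈ S, MvPowerSeries.C (w k)))}) := modelChartsOverCentre_isLocalRing_quot 𝔔 hf𝔔
  obtain ⟨hreg, hG, w', h1, h2, h3⟩ := modelChartsOverCentre_chartX_package (![MvPowerSeries.X 0, MvPowerSeries.X 1, MvPowerSeries.C x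
        , MvPowerSeries.C y] : Fin 4 → MvPowerSeries (Fin 2) A)
    (fun k => MvPowerSeries.C (w k)) hzP hdP 𝔓 h𝔓 hc S T (MvPowerSeries.X 0) rfl 𝔔 h𝔔 L hf𝔔
  rw [← modelChartsOverCentre_C_boundary_of x y w T b hb (![MvPowerSeries.X 0, MvPowerSeries.X 1, MvPowerSeries.C x, MvPowerSeries.C y] : Fin 4
        → MvPowerSeries (Fin 2) A) rfl] at h1 h2
  exact ⟨blowupAlgebra.gen 𝔓 (MvPowerSeries.X 0) ((![MvPowerSeries.X 0, MvPowerSeries.X 1, MvPowerSeries.C x, MvPowerSeries.C y] : Fin 4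
        → MvPowerSeries (Fin 2) A) 0) (hc 0) * blowupAlgebra.gen 𝔓 (MvPowerSeries.X 0) ((![MvPowerSeries.X 0, MvPowerSeries.X 1, MvPowerSeries.C x
        , MvPowerSeries.C y] : Fin 4 → MvPowerSeries (Fin 2) A) 1) (hc 1) - blowupAlgebra.gen 𝔓 (MvPowerSeries.X 0) ((![MvPowerSeries.X 0
        , MvPowerSeries.X 1, MvPowerSeries.C x, MvPowerSeries.C y] : Fin 4 → MvPowerSeries (Fin 2) A) 2) (hc 2) * blowupAlgebra.gen 𝔓
        (MvPowerSeries.X 0) ((![MvPowerSeries.X 0, MvPowerSeries.X 1, MvPowerSeries.C x, MvPowerSeries.C y] : Fin 4 → MvPowerSeries (Fin 2) A) 3)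
        (hc 3) * algebraMap (MvPowerSeries (Fin 2) A) (blowupAlgebra 𝔓 (MvPowerSeries.X 0)) (∏ k ∈ S, MvPowerSeries.C (w k)), hO, hfF, hG, w', h1
        , h2, fun _ => h3, fun hn => absurd hreg hn⟩

/-- The reordered generators `(X₁, X₀, C x, C y)` generate the same ideal. [folklore] -/
theorem modelChartsOverCentre_span_swap {A : Type} [CommRing A] (x y : A) :
    Ideal.span (Set.range (![MvPowerSeries.X 1, MvPowerSeries.X 0, MvPowerSeries.C x, MvPowerSeries.C y] : Fin 4 → MvPowerSeries (Fin 2) A))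
          = Ideal.span (Set.range (![MvPowerSeries.X 0, MvPowerSeries.X 1, MvPowerSeries.C x, MvPowerSeries.C y] : Fin 4 → MvPowerSeries
          (Fin 2) A)) := by
  rw [Set.range_vec4', Set.range_vec4', Set.insert_comm]

/-- The reordered family `(X₁, X₀, C x, C y, C w)` has the same range. [folklore] -/
theorem modelChartsOverCentre_range_append_swap {A : Type} [CommRing A] {l : ℕ} (x y : A) (w : Fin l → A) :
    Set.range (Fin.append (![MvPowerSeries.X 1, MvPowerSeries.X 0, MvPowerSeries.C x, MvPowerSeries.C y] : Fin 4 → MvPowerSeries (Fin 2) A)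
          (fun k => MvPowerSeries.C (w k))) =
      Set.range (Fin.append (![MvPowerSeries.X 0, MvPowerSeries.X 1, MvPowerSeries.C x, MvPowerSeries.C y] : Fin 4 → MvPowerSeries (Fin 2) A)
            (fun k => MvPowerSeries.C (w k))) := by
  rw [Set.range_fin_append, Set.range_fin_append, Set.range_vec4', Set.range_vec4', Set.insert_comm]

set_option maxHeartbeats 4000000 in
/-- **The chart package on the chart "`v ≠ 0`"** of the blown-up model at a closed point over the
closed point: with `f` the strict transform of `uv - h` (`uv - h = v² f` on the chart), `O = L/(f)` is
regular, the exceptional generator `v` is a non-zero-divisor of `O`, the boundary `x y ∏_{k ∈ T} w_k`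
is `v² w'` with `√((v² w') Ô) = (v w') Ô` and `(v w')` an ideal with local strict normal crossings
data (de Jong 1996, 4.27: "Chart "`u ≠ 0`" … Clearly, this is smooth and `Z` is given by
`ut₁'t₂'t₃ ⋯ t_r = 0`, a normal crossings divisor"; the chart "`v ≠ 0`" is symmetric).
[cite: DeJong1996, 4.27, p. 76] -/
theorem modelChartsOverCentre_package_X1 {A : Type} [CommRing A] [IsRegularLocalRing A] {l : ℕ}
    (x y : A) (w : Fin l → A) (S T : Finset (Fin l)) (_hST : S ⊆ T)
    (hzA : Ideal.span (Set.range (Fin.append ![x, y] w)) = maximalIdeal A)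
    (hdA : (maximalIdeal A).spanFinrank = 2 + l)
    (h b : A) (hh : h = x * y * ∏ k ∈ S, w k) (hb : b = x * y * ∏ k ∈ T, w k)
    (𝔓 : Ideal (MvPowerSeries (Fin 2) A)) (h𝔓 : 𝔓 = Ideal.span (Set.range (![MvPowerSeries.X 0, MvPowerSeries.X 1, MvPowerSeries.C x
          , MvPowerSeries.C y] : Fin 4 → MvPowerSeries (Fin 2) A)))
    (𝔔 : Ideal (blowupAlgebra 𝔓 (MvPowerSeries.X 1))) [𝔔.IsMaximal]
    (h𝔔 : 𝔔.comap (algebraMap (MvPowerSeries (Fin 2) A) (blowupAlgebra 𝔓 (MvPowerSeries.X 1))) = maximalIdeal (MvPowerSeries (Fin 2) A))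
    (hfmem : ∀ f : blowupAlgebra 𝔓 (MvPowerSeries.X 1), algebraMap (MvPowerSeries (Fin 2) A) (blowupAlgebra 𝔓 (MvPowerSeries.X 1))
          (DeJong1996.nodeDeformationRelation A h) = algebraMap (MvPowerSeries (Fin 2) A) (blowupAlgebra 𝔓 (MvPowerSeries.X 1))
          (MvPowerSeries.X 1) ^ 2 * f → f ∈ 𝔔)
    (L : Type) [CommRing L] [IsLocalRing L] [Algebra (blowupAlgebra 𝔓 (MvPowerSeries.X 1)) L] [IsLocalization.AtPrime L 𝔔] :
    ∃ (f : blowupAlgebra 𝔓 (MvPowerSeries.X 1)) (_ : IsLocalRing (L ⧸ Ideal.span {algebraMap (blowupAlgebra 𝔓 (MvPowerSeries.X 1)) L (f)})),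
      algebraMap (MvPowerSeries (Fin 2) A) (blowupAlgebra 𝔓 (MvPowerSeries.X 1)) (DeJong1996.nodeDeformationRelation A h) = algebraMap
            (MvPowerSeries (Fin 2) A) (blowupAlgebra 𝔓 (MvPowerSeries.X 1)) (MvPowerSeries.X 1) ^ 2 * f ∧
      Ideal.Quotient.mk (Ideal.span {algebraMap (blowupAlgebra 𝔓 (MvPowerSeries.X 1)) L (f)}) (algebraMap (blowupAlgebra 𝔓 (MvPowerSeries.X 1)) L
            (algebraMap (MvPowerSeries (Fin 2) A) (blowupAlgebra 𝔓 (MvPowerSeries.X 1)) (MvPowerSeries.X 1))) ∈ nonZeroDivisors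
            (L ⧸ Ideal.span {algebraMap (blowupAlgebra 𝔓 (MvPowerSeries.X 1)) L (f)}) ∧
      ∃ w' : (L ⧸ Ideal.span {algebraMap (blowupAlgebra 𝔓 (MvPowerSeries.X 1)) L (f)}),
        Ideal.span {Ideal.Quotient.mk (Ideal.span {algebraMap (blowupAlgebra 𝔓 (MvPowerSeries.X 1)) L (f)}) (algebraMap (blowupAlgebra 𝔓
              (MvPowerSeries.X 1)) L (algebraMap (MvPowerSeries (Fin 2) A) (blowupAlgebra 𝔓 (MvPowerSeries.X 1)) (MvPowerSeries.C b)))}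
              = Ideal.span {Ideal.Quotient.mk (Ideal.span {algebraMap (blowupAlgebra 𝔓 (MvPowerSeries.X 1)) L (f)}) (algebraMap (blowupAlgebra 𝔓
              (MvPowerSeries.X 1)) L (algebraMap (MvPowerSeries (Fin 2) A) (blowupAlgebra 𝔓 (MvPowerSeries.X 1)) (MvPowerSeries.X 1))) ^ 2 * w'} ∧
        ((Ideal.span {Ideal.Quotient.mk (Ideal.span {algebraMap (blowupAlgebra 𝔓 (MvPowerSeries.X 1)) L (f)}) (algebraMap (blowupAlgebra 𝔓
              (MvPowerSeries.X 1)) L (algebraMap (MvPowerSeries (Fin 2) A) (blowupAlgebra 𝔓 (MvPowerSeries.X 1)) (MvPowerSeries.C b)))}).map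
              (algebraMap (L ⧸ Ideal.span {algebraMap (blowupAlgebra 𝔓 (MvPowerSeries.X 1)) L (f)}) (AdicCompletion (maximalIdeal
              (L ⧸ Ideal.span {algebraMap (blowupAlgebra 𝔓 (MvPowerSeries.X 1)) L (f)})) (L ⧸ Ideal.span {algebraMap (blowupAlgebra 𝔓
              (MvPowerSeries.X 1)) L (f)})))).radical =
          (Ideal.span {Ideal.Quotient.mk (Ideal.span {algebraMap (blowupAlgebra 𝔓 (MvPowerSeries.X 1)) L (f)}) (algebraMap (blowupAlgebra 𝔓
                (MvPowerSeries.X 1)) L (algebraMap (MvPowerSeries (Fin 2) A) (blowupAlgebra 𝔓 (MvPowerSeries.X 1)) (MvPowerSeries.X 1))) * w'}).map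
                (algebraMap (L ⧸ Ideal.span {algebraMap (blowupAlgebra 𝔓 (MvPowerSeries.X 1)) L (f)}) (AdicCompletion (maximalIdeal
                (L ⧸ Ideal.span {algebraMap (blowupAlgebra 𝔓 (MvPowerSeries.X 1)) L (f)})) (L ⧸ Ideal.span {algebraMap (blowupAlgebra 𝔓
                (MvPowerSeries.X 1)) L (f)}))) ∧
        (IsRegularLocalRing (L ⧸ Ideal.span {algebraMap (blowupAlgebra 𝔓 (MvPowerSeries.X 1)) L (f)}) → IsSNCIdeal (Ideal.span {Ideal.Quotient.mk
              (Ideal.span {algebraMap (blowupAlgebra 𝔓 (MvPowerSeries.X 1)) L (f)}) (algebraMap (blowupAlgebra 𝔓 (MvPowerSeries.X 1)) L (algebraMap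
              (MvPowerSeries (Fin 2) A) (blowupAlgebra 𝔓 (MvPowerSeries.X 1)) (MvPowerSeries.X 1))) * w'})) ∧
        (¬ IsRegularLocalRing (L ⧸ Ideal.span {algebraMap (blowupAlgebra 𝔓 (MvPowerSeries.X 1)) L (f)}) →
          ∃ (A' : Type) (_ : CommRing A') (_ : IsRegularLocalRing A') (t' : Fin (l + 2) → A') (s' r' : ℕ),
            Ideal.span (Set.range t') = maximalIdeal A' ∧ ringKrullDim A' = (l + 2 : ℕ) ∧
            2 ≤ s' ∧ s' ≤ r' ∧ r' ≤ l + 2 ∧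
            ∃ e : AdicCompletion (maximalIdeal (L ⧸ Ideal.span {algebraMap (blowupAlgebra 𝔓 (MvPowerSeries.X 1)) L (f)}))
                  (L ⧸ Ideal.span {algebraMap (blowupAlgebra 𝔓 (MvPowerSeries.X 1)) L (f)}) ≃+*
                DeJong1996.NodeDeformationRing A'
                  (∏ i ∈ Finset.univ.filter (fun i : Fin (l + 2) => i.val < s'), t' i),
              ((Ideal.span {Ideal.Quotient.mk (Ideal.span {algebraMap (blowupAlgebra 𝔓 (MvPowerSeries.X 1)) L (f)}) (algebraMap (blowupAlgebra 𝔓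
                    (MvPowerSeries.X 1)) L (algebraMap (MvPowerSeries (Fin 2) A) (blowupAlgebra 𝔓 (MvPowerSeries.X 1)) (MvPowerSeries.X 1)))
                    * w'}).map (algebraMap (L ⧸ Ideal.span {algebraMap (blowupAlgebra 𝔓 (MvPowerSeries.X 1)) L (f)}) _)).map e.toRingHom =
                Ideal.span {DeJong1996.NodeDeformationRing.ofBase A' _
                  (∏ i ∈ Finset.univ.filter (fun i : Fin (l + 2) => i.val < r'), t' i)}) := by
  classical
  haveI := isRegularLocalRing_mvPowerSeries_of_isRegularLocalRing A 2
  have hc : ∀ k, (![MvPowerSeries.X 0, MvPowerSeries.X 1, MvPowerSeries.C x, MvPowerSeries.C y] : Fin 4 → MvPowerSeries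
        (Fin 2) A) k ∈ 𝔓 := modelChartsOverCentre_mem_centre x y 𝔓 h𝔓
  have h𝔓' : 𝔓 = Ideal.span (Set.range (![MvPowerSeries.X 1, MvPowerSeries.X 0, MvPowerSeries.C x, MvPowerSeries.C y] : Fin 4 → MvPowerSeries
        (Fin 2) A)) := h𝔓.trans (modelChartsOverCentre_span_swap x y).symm
  have hc' : ∀ k, (![MvPowerSeries.X 1, MvPowerSeries.X 0, MvPowerSeries.C x, MvPowerSeries.C y] : Fin 4 → MvPowerSeries
        (Fin 2) A) k ∈ 𝔓 := fun k => by rw [h𝔓']; exact Ideal.subset_span ⟨k, rfl⟩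
  obtain ⟨hzP, hdP⟩ := chartsOverCentre_model_rsop x y w hzA hdA
  rw [← modelChartsOverCentre_range_append_swap x y w] at hzP
  have hF := modelChartsOverCentre_relation_eq_of x y w S h hh (![MvPowerSeries.X 1, MvPowerSeries.X 0, MvPowerSeries.C x
        , MvPowerSeries.C y] : Fin 4 → MvPowerSeries (Fin 2) A) (mul_comm _ _) rfl
  have hfF : algebraMap (MvPowerSeries (Fin 2) A) (blowupAlgebra 𝔓 (MvPowerSeries.X 1)) (DeJong1996.nodeDeformationRelation A h) = algebraMap
        (MvPowerSeries (Fin 2) A) (blowupAlgebra 𝔓 (MvPowerSeries.X 1)) (MvPowerSeries.X 1) ^ 2 * (blowupAlgebra.gen 𝔓 (MvPowerSeries.X 1)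
        ((![MvPowerSeries.X 1, MvPowerSeries.X 0, MvPowerSeries.C x, MvPowerSeries.C y] : Fin 4 → MvPowerSeries (Fin 2) A) 0) (hc' 0)
        * blowupAlgebra.gen 𝔓 (MvPowerSeries.X 1) ((![MvPowerSeries.X 1, MvPowerSeries.X 0, MvPowerSeries.C x, MvPowerSeries.C y] : Fin 4
        → MvPowerSeries (Fin 2) A) 1) (hc' 1) - blowupAlgebra.gen 𝔓 (MvPowerSeries.X 1) ((![MvPowerSeries.X 1, MvPowerSeries.X 0, MvPowerSeries.C x
        , MvPowerSeries.C y] : Fin 4 → MvPowerSeries (Fin 2) A) 2) (hc' 2) * blowupAlgebra.gen 𝔓 (MvPowerSeries.X 1) ((![MvPowerSeries.X 1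
        , MvPowerSeries.X 0, MvPowerSeries.C x, MvPowerSeries.C y] : Fin 4 → MvPowerSeries (Fin 2) A) 3) (hc' 3) * algebraMap (MvPowerSeries
        (Fin 2) A) (blowupAlgebra 𝔓 (MvPowerSeries.X 1)) (∏ k ∈ S, MvPowerSeries.C (w k))) := by
    rw [hF]
    exact modelChartsOverCentre_algebraMap_relation_of_eq (![MvPowerSeries.X 1, MvPowerSeries.X 0, MvPowerSeries.C x, MvPowerSeries.C y] : Fin 4
          → MvPowerSeries (Fin 2) A) 𝔓 hc' 0 (MvPowerSeries.X 1) rfl _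
  have hf𝔔 := hfmem _ hfF
  haveI hO : IsLocalRing (L ⧸ Ideal.span {algebraMap (blowupAlgebra 𝔓 (MvPowerSeries.X 1)) L (blowupAlgebra.gen 𝔓 (MvPowerSeries.X 1)
        ((![MvPowerSeries.X 1, MvPowerSeries.X 0, MvPowerSeries.C x, MvPowerSeries.C y] : Fin 4 → MvPowerSeries (Fin 2) A) 0) (hc' 0)
        * blowupAlgebra.gen 𝔓 (MvPowerSeries.X 1) ((![MvPowerSeries.X 1, MvPowerSeries.X 0, MvPowerSeries.C x, MvPowerSeries.C y] : Fin 4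
        → MvPowerSeries (Fin 2) A) 1) (hc' 1) - blowupAlgebra.gen 𝔓 (MvPowerSeries.X 1) ((![MvPowerSeries.X 1, MvPowerSeries.X 0, MvPowerSeries.C x
        , MvPowerSeries.C y] : Fin 4 → MvPowerSeries (Fin 2) A) 2) (hc' 2) * blowupAlgebra.gen 𝔓 (MvPowerSeries.X 1) ((![MvPowerSeries.X 1
        , MvPowerSeries.X 0, MvPowerSeries.C x, MvPowerSeries.C y] : Fin 4 → MvPowerSeries (Fin 2) A) 3) (hc' 3) * algebraMap (MvPowerSeries
        (Fin 2) A) (blowupAlgebra 𝔓 (MvPowerSeries.X 1)) (∏ k ∈ S, MvPowerSeries.C (w k)))}) := modelChartsOverCentre_isLocalRing_quot 𝔔 hf𝔔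
  obtain ⟨hreg, hG, w', h1, h2, h3⟩ := modelChartsOverCentre_chartX_package (![MvPowerSeries.X 1, MvPowerSeries.X 0, MvPowerSeries.C x
        , MvPowerSeries.C y] : Fin 4 → MvPowerSeries (Fin 2) A)
    (fun k => MvPowerSeries.C (w k)) hzP hdP 𝔓 h𝔓' hc' S T (MvPowerSeries.X 1) rfl 𝔔 h𝔔 L hf𝔔
  rw [← modelChartsOverCentre_C_boundary_of x y w T b hb (![MvPowerSeries.X 1, MvPowerSeries.X 0, MvPowerSeries.C x, MvPowerSeries.C y] : Fin 4
        → MvPowerSeries (Fin 2) A) rfl] at h1 h2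
  exact ⟨blowupAlgebra.gen 𝔓 (MvPowerSeries.X 1) ((![MvPowerSeries.X 1, MvPowerSeries.X 0, MvPowerSeries.C x, MvPowerSeries.C y] : Fin 4
        → MvPowerSeries (Fin 2) A) 0) (hc' 0) * blowupAlgebra.gen 𝔓 (MvPowerSeries.X 1) ((![MvPowerSeries.X 1, MvPowerSeries.X 0, MvPowerSeries.C x
        , MvPowerSeries.C y] : Fin 4 → MvPowerSeries (Fin 2) A) 1) (hc' 1) - blowupAlgebra.gen 𝔓 (MvPowerSeries.X 1) ((![MvPowerSeries.X 1
        , MvPowerSeries.X 0, MvPowerSeries.C x, MvPowerSeries.C y] : Fin 4 → MvPowerSeries (Fin 2) A) 2) (hc' 2) * blowupAlgebra.gen 𝔓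
        (MvPowerSeries.X 1) ((![MvPowerSeries.X 1, MvPowerSeries.X 0, MvPowerSeries.C x, MvPowerSeries.C y] : Fin 4 → MvPowerSeries (Fin 2) A) 3)
        (hc' 3) * algebraMap (MvPowerSeries (Fin 2) A) (blowupAlgebra 𝔓 (MvPowerSeries.X 1)) (∏ k ∈ S, MvPowerSeries.C (w k)), hO, hfF, hG, w', h1
        , h2, fun _ => h3, fun hn => absurd hreg hn⟩

end Summit.ResolutionOfSingularities.ResolutionOfSingularities.Theorems

end
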